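import Mathlib
import Summits.MatrixMultiplication.MatrixMultiplication.Theorems.SnSubsetDichotomyNoThresholdSubsetTripleDefs

/-!
# `SnSubsetDichotomy.NoThresholdSubsetTriple`, line `sidon-regime-hereditary-density` — stub
# `stub_hdCount` (the hereditary-density count)

Registered stub `stub_hdCount` of the skeleton
`Cruxes/NoThresholdSubsetTriple/Lines/sidon-regime-hereditary-density.lean` (crux
`stmt-MatrixMultiplication-8302`), in the vocabulary of
`…Theorems.SnSubsetDichotomyNoThresholdSubsetTripleDefs` (`diffSet`, `overlap`, `selfOverlap`,
`HDCount`).  For every finite group `G`, subgroup `H ≤ G` and `X ⊆ G`: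

`|X|² ≤ [G:H] · (|X| + m(X) · |D_X ∩ H|)`,

where `D_X = X·X⁻¹ ∖ {1}` and `m(X) = max_{g ≠ 1} #{x ∈ X : g x ∈ X}`.

Proof.  Let `P = {(s,s') ∈ X² : s s'⁻¹ ∈ H}` be the set of ordered pairs of `X` lying in a common
right coset of `H`; equivalently `π s = π s'` for `π x := x⁻¹H ∈ G ⧸ H` (`QuotientGroup.eq`).
* Cauchy–Schwarz over the `[G:H]` fibres of `π` (`sq_sum_le_card_mul_sum_sq`, with
  `a_c = #{x ∈ X : π x = c}`, `Σ_c a_c = |X|`, `Σ_c a_c² = |P|`): `|X|² ≤ [G:H] · |P|`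
  (`card_sq_le_card_mul_card_filter_prod`, `card_sq_le_index_mul_card_cosetPairs`).
* `|P| ≤ |X| + m(X) · |D_X ∩ H|` (`card_cosetPairs_le`): the diagonal pairs inject into `X`; an
  off-diagonal pair `(s,s')` has quotient `d = s s'⁻¹ ∈ D_X ∩ H`, and the fibre of `d` injects via
  `(s,s') ↦ s'` into `{x ∈ X : d x ∈ X}`, of size `overlap d X ≤ m(X)` (`overlap_le_selfOverlap`).
-/

-- `Summit.<Summit>.<Problem>`: summit and problem coincide for this single-conjunct summit.
set_option linter.dupNamespace false

noncomputable section

open scoped Classical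
open Finset

namespace Summit.MatrixMultiplication.MatrixMultiplication.Theorems.NoThresholdSubsetTriple

/-- **Cauchy–Schwarz over the fibres of a map to a finite type.**  For `s : Finset α` and
`f : α → β` with `β` finite, `|s|² ≤ |β| · #{(a,b) ∈ s × s : f a = f b}`
(`Σ_c a_c = |s|`, `Σ_c a_c² = #pairs in a common fibre`, `a_c = #{x ∈ s : f x = c}`). -/
theorem card_sq_le_card_mul_card_filter_prod {α β : Type*} [Fintype β] [DecidableEq β]
    (s : Finset α) (f : α → β) :
    s.card ^ 2 ≤ Fintype.card β * ((s ×ˢ s).filter fun p => f p.1 = f p.2).card := by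
  have h1 : s.card = ∑ b : β, (s.filter fun a => f a = b).card :=
    card_eq_sum_card_fiberwise fun _ _ => mem_coe.2 (mem_univ _)
  have h3 : ((s ×ˢ s).filter fun p => f p.1 = f p.2).card =
      ∑ b : β, (((s ×ˢ s).filter fun p => f p.1 = f p.2).filter fun p => f p.1 = b).card :=
    card_eq_sum_card_fiberwise fun _ _ => mem_coe.2 (mem_univ _)
  have h2 : ∀ b : β, (((s ×ˢ s).filter fun p => f p.1 = f p.2).filter fun p => f p.1 = b) =
      (s.filter fun a => f a = b) ×ˢ (s.filter fun a => f a = b) := by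
    intro b
    ext ⟨x, y⟩
    simp only [mem_filter, mem_product]
    constructor
    · rintro ⟨⟨⟨hx, hy⟩, hxy⟩, hb⟩
      exact ⟨⟨hx, hb⟩, hy, hxy.symm.trans hb⟩
    · rintro ⟨⟨hx, hb⟩, hy, hb'⟩
      exact ⟨⟨⟨hx, hy⟩, hb.trans hb'.symm⟩, hb⟩
  calc s.card ^ 2 = (∑ b : β, (s.filter fun a => f a = b).card) ^ 2 := by rw [h1]
    _ ≤ (univ : Finset β).card * ∑ b : β, (s.filter fun a => f a = b).card ^ 2 :=
        sq_sum_le_card_mul_sum_sq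
    _ = Fintype.card β * ((s ×ˢ s).filter fun p => f p.1 = f p.2).card := by
        rw [card_univ, h3]
        refine congrArg _ (sum_congr rfl fun b _ => ?_)
        rw [h2, card_product, sq]

section General

variable {G : Type*} [Group G] [Fintype G]

/-- **Cauchy–Schwarz over the right cosets.**  The ordered pairs `(s,s') ∈ X²` lying in a common
right coset of `H` (`s s'⁻¹ ∈ H`) number at least `|X|²/[G:H]`:
`|X|² ≤ [G:H] · #{(s,s') ∈ X² : s s'⁻¹ ∈ H}`. -/
theorem card_sq_le_index_mul_card_cosetPairs (H : Subgroup G) (X : Finset G) :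
    X.card ^ 2 ≤ H.index * ((X ×ˢ X).filter fun p => p.1 * p.2⁻¹ ∈ H).card := by
  have hfilter : ((X ×ˢ X).filter fun p : G × G =>
      ((p.1⁻¹ : G) : G ⧸ H) = ((p.2⁻¹ : G) : G ⧸ H)) =
        (X ×ˢ X).filter fun p => p.1 * p.2⁻¹ ∈ H :=
    filter_congr fun p _ => by rw [QuotientGroup.eq, inv_inv]
  calc X.card ^ 2 ≤ Fintype.card (G ⧸ H) * ((X ×ˢ X).filter fun p : G × G =>
          ((p.1⁻¹ : G) : G ⧸ H) = ((p.2⁻¹ : G) : G ⧸ H)).card :=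
        card_sq_le_card_mul_card_filter_prod X fun x : G => ((x⁻¹ : G) : G ⧸ H)
    _ = H.index * ((X ×ˢ X).filter fun p => p.1 * p.2⁻¹ ∈ H).card := by
        rw [hfilter, Subgroup.index_eq_card, Nat.card_eq_fintype_card]

variable [DecidableEq G]

/-- **Diagonal / off-diagonal count of the coset pairs.**  `#{(s,s') ∈ X² : s s'⁻¹ ∈ H} ≤
|X| + m(X) · |D_X ∩ H|`: the diagonal pairs inject into `X` and, for each `d ∈ D_X ∩ H`, the
off-diagonal pairs with quotient `s s'⁻¹ = d` inject via `(s,s') ↦ s'` into `{x ∈ X : d x ∈ X}`,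
of size `overlap d X ≤ selfOverlap X`. -/
theorem card_cosetPairs_le (H : Subgroup G) (X : Finset G) :
    ((X ×ˢ X).filter fun p => p.1 * p.2⁻¹ ∈ H).card ≤
      X.card + selfOverlap X * ((diffSet X).filter (· ∈ H)).card := by
  rw [← card_filter_add_card_filter_not (s := (X ×ˢ X).filter fun p => p.1 * p.2⁻¹ ∈ H)
    (fun p : G × G => p.1 = p.2)]
  refine Nat.add_le_add ?_ ?_
  · -- the diagonal pairs inject into `X` via the first coordinate
    refine card_le_card_of_injOn Prod.fst (fun p hp => ?_) (fun p hp q hq h => ?_)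
    · rw [mem_coe, mem_filter, mem_filter, mem_product] at hp
      exact hp.1.1.1
    · rw [mem_coe, mem_filter] at hp hq
      exact Prod.ext h (hp.2.symm.trans (h.trans hq.2))
  · -- the off-diagonal pairs, fibred over the quotient `d = s s'⁻¹ ∈ D_X ∩ H`
    have hmaps : ((((X ×ˢ X).filter fun p => p.1 * p.2⁻¹ ∈ H).filter
        fun p : G × G => ¬ p.1 = p.2 : Finset (G × G)) : Set (G × G)).MapsTo
          (fun p : G × G => p.1 * p.2⁻¹) ((diffSet X).filter (· ∈ H) : Finset G) := by
      intro p hp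
      rw [mem_coe, mem_filter, mem_filter, mem_product] at hp
      rw [mem_coe, mem_filter, mem_diffSet]
      exact ⟨⟨fun h => hp.2 (mul_inv_eq_one.1 h), p.1, hp.1.1.1, p.2, hp.1.1.2, rfl⟩, hp.1.2⟩
    rw [card_eq_sum_card_fiberwise hmaps]
    calc ∑ d ∈ (diffSet X).filter (· ∈ H),
          ((((X ×ˢ X).filter fun p => p.1 * p.2⁻¹ ∈ H).filter
            fun p : G × G => ¬ p.1 = p.2).filter fun p : G × G => p.1 * p.2⁻¹ = d).card
        ≤ ∑ _d ∈ (diffSet X).filter (· ∈ H), selfOverlap X := by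
          refine sum_le_sum fun d hd => ?_
          have hd1 : d ≠ 1 := (mem_diffSet.1 (mem_filter.1 hd).1).1
          refine le_trans ?_ (overlap_le_selfOverlap hd1)
          show _ ≤ (X.filter fun x => d * x ∈ X).card
          refine card_le_card_of_injOn Prod.snd (fun p hp => ?_) (fun p hp q hq h => ?_)
          · rw [mem_coe, mem_filter, mem_filter, mem_filter, mem_product] at hp
            rw [mem_coe, mem_filter]
            refine ⟨hp.1.1.1.2, ?_⟩
            rw [← hp.2, inv_mul_cancel_right]
            exact hp.1.1.1.1
          · rw [mem_coe, mem_filter] at hp hq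
            refine Prod.ext ?_ h
            calc p.1 = p.1 * p.2⁻¹ * p.2 := (inv_mul_cancel_right _ _).symm
              _ = q.1 * q.2⁻¹ * q.2 := by rw [hp.2, hq.2, h]
              _ = q.1 := inv_mul_cancel_right _ _
      _ = selfOverlap X * ((diffSet X).filter (· ∈ H)).card := by
          rw [sum_const, smul_eq_mul, mul_comm]

end General

/-- **STUB `stub_hdCount` — the hereditary-density count** (registered stub of the line
`sidon-regime-hereditary-density`, any finite group): for every subgroup `H ≤ G` and `X ⊆ G`,
`|X|² ≤ [G:H] · (|X| + m(X) · |D_X ∩ H|)` — Cauchy–Schwarz over the `[G:H]` right cosets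
(`card_sq_le_index_mul_card_cosetPairs`) followed by the diagonal / off-diagonal count of the
pairs in a common coset (`card_cosetPairs_le`). -/
theorem stub_hdCount :
    ∀ (G : Type) [Group G] [Fintype G] [DecidableEq G] (H : Subgroup G) (X : Finset G),
      X.card ^ 2 ≤ H.index * (X.card + selfOverlap X * ((diffSet X).filter (· ∈ H)).card) :=
  fun _ _ _ _ H X =>
    (card_sq_le_index_mul_card_cosetPairs H X).trans (Nat.mul_le_mul_left _ (card_cosetPairs_le H X))

/-- The hereditary-density count in the packaged form `HDCount` of the vocabulary file. -/
theorem hdCount : HDCount :=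
  stub_hdCount

end Summit.MatrixMultiplication.MatrixMultiplication.Theorems.NoThresholdSubsetTriple

end
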